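import Mathlib.Tactic
import Summits.ValiantsHypothesis.ValiantsHypothesis.Theorems.RowSmlDepthFour
import HarnessLib

/-!
# The cut-crossing law for row-set-multilinear `ΣΠΣΠ` expressions of the permanent
(decomposition workshop `decomp-valiant`, lens 6 «restricted-models lifting axis», gen 3 — pins
the OPEN content of the depth-4 rung `Theorems.RowSmlDepthFour.PerRowSmlDepthFourHardExp`)

**What is proved** (`choose_le_sum_pow_crossing`). Let `per_n = Σ_t ∏_(blocks b of π t)
Σ_(u < w t) ∏_(rows i of b) q t b u i` be a row-set-multilinear `ΣΠΣΠ` expression with row-local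
bottom polynomials (`RowSmlDepthFour.depthFourEval`). For EVERY row set `S`, writing `k_t(S)` for
the number of blocks of the `t`-th term that meet both `S` and its complement
(`crossingBlocks S (π t)`):

  `C(n,|S|) ≤ Σ_t (w t)^(k_t(S))`.

Proof: split each term as (blocks inside `S`) · (blocks inside `Sᶜ`) · ∏_(crossing blocks); expand
each crossing block `Σ_u (∏_(i ∈ b ∩ S) q)(∏_(i ∈ b \\ S) q)` and distribute: the term becomes a
sum of `(w t)^(k_t)` products `f · g` with `f ∈ F[rows S]`, `g ∈ F[rows Sᶜ]`, and the block
flattening law `Theorems.RowPartitionRank.choose_le_of_perPoly_eq_sum_mul_blockLocal` bounds the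
number of summands below by `C(n,|S|)`.

Special cases: depth 3 (singleton blocks never cross: `k_t = 0`, so `s ≥ C(n,|S|)`, the flattening
bound of `RowPartitionRank`); `S`-adapted expressions (`k_t = 0` for all `t`,
`RowSmlDepthFour.choose_le_size_of_adapted` up to the vanishing terms). WHAT IT SAYS ABOUT THE OPEN
RUNG: a depth-4 expression of `per_n` of size `2^(o(n))` must have, for every balanced cut `S`,
`Σ_t (w t)^(k_t(S)) ≥ 2^n/(n+1)` — its terms must cross every balanced cut in `Ω(n / log w)` blocks,
i.e. use many small blocks in "generic position"; this is the regime where the rank method stalls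
at `2^(O(√n))` and where new ideas are needed.

HONEST FRAMING: an unconditional structural inequality; nothing here is evidence for `VP ≠ VNP`,
which is NOT proved.

## References
* [NisanWigderson1996] N. Nisan, A. Wigderson, *Lower bounds on arithmetic circuits via partial
  derivatives*, Comput. Complexity 6 (1996/97), §3 (the partial-derivative / flattening method).
* [ArvindRaja2016] V. Arvind, S. Raja, Chicago J. Theoret. Comput. Sci. 2016, Art. 6, Remark 1.1.
-/

-- layout Summits/ValiantsHypothesis/ValiantsHypothesis forces the duplicated namespace component
set_option linter.dupNamespace false

namespace Summit.ValiantsHypothesis.ValiantsHypothesis.Theorems.CutCrossingLaw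

open Finset MvPolynomial Literature.Computability.AlgebraicComplexity
open Summit.ValiantsHypothesis.ValiantsHypothesis.Theorems.RowSmlDepthFour

noncomputable section

/-- The blocks (labels) of the row partition `p` that meet both `S` and its complement. -/
def crossingBlocks {n : ℕ} (S : Finset (Fin n)) (p : Fin n → Fin n) : Finset (Fin n) :=
  open Classical in univ.filter fun b => (∃ i, i ∈ S ∧ p i = b) ∧ (∃ i, i ∉ S ∧ p i = b)

/-- Membership in `crossingBlocks`. [folklore] -/
theorem mem_crossingBlocks {n : ℕ} (S : Finset (Fin n)) (p : Fin n → Fin n) (b : Fin n) :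
    b ∈ crossingBlocks S p ↔ (∃ i, i ∈ S ∧ p i = b) ∧ (∃ i, i ∉ S ∧ p i = b) := by
  unfold crossingBlocks
  simp only [Finset.mem_filter, Finset.mem_univ, true_and]

/-- Singleton blocks (depth 3) never cross. [folklore] -/
theorem crossingBlocks_id {n : ℕ} (S : Finset (Fin n)) : crossingBlocks S id = ∅ := by
  ext b
  simp only [mem_crossingBlocks, id, Finset.notMem_empty, iff_false]
  rintro ⟨⟨i, hi, rfl⟩, ⟨j, hj, hji⟩⟩
  exact hj (by rw [hji]; exact hi)

variable {F : Type*} [Field F]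

/-- **The cut-crossing law.** For every row set `S`, a row-set-multilinear `ΣΠΣΠ` expression of
`per_n` satisfies `C(n,|S|) ≤ Σ_t (w t)^(k_t(S))`, `k_t(S)` = the number of blocks of the `t`-th term
crossing the cut `S`. [cite: NisanWigderson1996, Thm. 3.2 (method)] -/
theorem choose_le_sum_pow_crossing (n s : ℕ) (w : Fin s → ℕ) (π : Fin s → Fin n → Fin n)
    (q : (t : Fin s) → Fin n → Fin (w t) → Fin n → MvPolynomial (Fin n × Fin n) F)
    (hq : ∀ t b u i, ∃ g : MvPolynomial (Fin n) F, q t b u i = rename (Prod.mk i) g)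
    (h : perPoly (Fin n) F = depthFourEval n s w π q) (S : Finset (Fin n)) :
    n.choose S.card ≤ ∑ t, w t ^ (crossingBlocks S (π t)).card := by
  classical
  -- shorthand
  let Cr : Fin s → Finset (Fin n) := fun t => crossingBlocks S (π t)
  have memCr : ∀ t b, b ∈ Cr t ↔ (∃ i, i ∈ S ∧ π t i = b) ∧ (∃ i, i ∉ S ∧ π t i = b) :=
    fun t b => mem_crossingBlocks S (π t) b
  let blk : Fin s → Fin n → Finset (Fin n) := fun t b => univ.filter fun i => π t i = b
  let fq : (t : Fin s) → Fin n → Fin (w t) → MvPolynomial (Fin n × Fin n) F :=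
    fun t b u => ∏ i ∈ (blk t b).filter (fun i => i ∈ S), q t b u i
  let gq : (t : Fin s) → Fin n → Fin (w t) → MvPolynomial (Fin n × Fin n) F :=
    fun t b u => ∏ i ∈ (blk t b).filter (fun i => ¬ i ∈ S), q t b u i
  let Q : (t : Fin s) → Fin n → MvPolynomial (Fin n × Fin n) F :=
    fun t b => ∑ u : Fin (w t), ∏ i ∈ blk t b, q t b u i
  have hQ : ∀ t b, Q t b = ∑ u, fq t b u * gq t b u := fun t b =>
    Finset.sum_congr rfl fun u _ => (Finset.prod_filter_mul_prod_filter_not _ _ _).symm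
  let hasS : Fin s → Fin n → Prop := fun t b => ∃ i, i ∈ S ∧ π t i = b
  let Bl : Fin s → Finset (Fin n) := fun t => univ.image (π t)
  let NC : Fin s → Finset (Fin n) := fun t => (Bl t).filter fun b => ¬ b ∈ Cr t
  let Fp : Fin s → MvPolynomial (Fin n × Fin n) F :=
    fun t => ∏ b ∈ (NC t).filter (hasS t), Q t b
  let Gp : Fin s → MvPolynomial (Fin n × Fin n) F :=
    fun t => ∏ b ∈ (NC t).filter (fun b => ¬ hasS t b), Q t b
  -- each term = (crossing part) · (F_t · G_t)
  have hterm : ∀ t, ∏ b ∈ Bl t, Q t b = (∏ b ∈ (Bl t).filter (fun b => b ∈ Cr t), Q t b) * (Fp t * Gp t) := by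
    intro t
    have h1 := Finset.prod_filter_mul_prod_filter_not (Bl t) (fun b => b ∈ Cr t) (fun b => Q t b)
    have h2 := Finset.prod_filter_mul_prod_filter_not (NC t) (hasS t) (fun b => Q t b)
    rw [← h1]
    show _ = _ * ((∏ b ∈ (NC t).filter (hasS t), Q t b) *
      ∏ b ∈ (NC t).filter (fun b => ¬ hasS t b), Q t b)
    rw [h2]
  have hfilt : ∀ t, (Bl t).filter (fun b => b ∈ Cr t) = Cr t := by
    intro t
    ext b
    simp only [Finset.mem_filter, Bl, Finset.mem_image, Finset.mem_univ, true_and]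
    constructor
    · exact fun hb => hb.2
    · intro hb
      obtain ⟨⟨i, -, hi⟩, -⟩ := (memCr t b).mp hb
      exact ⟨⟨i, hi⟩, hb⟩
  -- the crossing part expands into `(w t)^(k_t)` products `f · g`
  have hcross : ∀ t, ∏ b ∈ Cr t, Q t b =
      ∑ φ : (↥(Cr t) → Fin (w t)),
        (∏ b : ↥(Cr t), fq t b (φ b)) * ∏ b : ↥(Cr t), gq t b (φ b) := by
    intro t
    rw [← Finset.prod_coe_sort (Cr t)]
    simp only [hQ]
    rw [Fintype.prod_sum]
    simp only [Finset.prod_mul_distrib]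
  -- the two halves, indexed by the sigma type of (term, choice on crossing blocks)
  let Sig := Σ t : Fin s, (↥(Cr t) → Fin (w t))
  let fS : Sig → MvPolynomial (Fin n × Fin n) F :=
    fun p => (∏ b : ↥(Cr p.1), fq p.1 b (p.2 b)) * Fp p.1
  let gS : Sig → MvPolynomial (Fin n × Fin n) F :=
    fun p => (∏ b : ↥(Cr p.1), gq p.1 b (p.2 b)) * Gp p.1
  have hper : perPoly (Fin n) F = ∑ t, ∑ φ : (↥(Cr t) → Fin (w t)), fS ⟨t, φ⟩ * gS ⟨t, φ⟩ := by
    rw [h]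
    refine Finset.sum_congr rfl fun t _ => ?_
    show ∏ b ∈ Bl t, Q t b = _
    rw [hterm t, hfilt t, hcross t, Finset.sum_mul]
    refine Finset.sum_congr rfl fun φ _ => ?_
    show _ = ((∏ b : ↥(Cr t), fq t b (φ b)) * Fp t) * ((∏ b : ↥(Cr t), gq t b (φ b)) * Gp t)
    ring
  have hper2 : perPoly (Fin n) F = ∑ p : Sig, fS p * gS p := by
    rw [hper, Fintype.sum_sigma]
  let e := Fintype.equivFin Sig
  have hper3 : perPoly (Fin n) F =
      ∑ k : Fin (Fintype.card Sig), fS (e.symm k) * gS (e.symm k) := by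
    rw [hper2]
    exact (Equiv.sum_comp e.symm (fun p => fS p * gS p)).symm
  -- locality
  have hfq : ∀ t b u, ∃ hh : MvPolynomial {ij : Fin n × Fin n // ij.1 ∈ S} F,
      fq t b u = rename Subtype.val hh := fun t b u =>
    isLocal_prod _ _ fun i hi => isLocal_of_rowLocal (Finset.mem_filter.mp hi).2 (hq t b u i)
  have hgq : ∀ t b u, ∃ hh : MvPolynomial {ij : Fin n × Fin n // ij.1 ∈ Sᶜ} F,
      gq t b u = rename Subtype.val hh := fun t b u =>
    isLocal_prod _ _ fun i hi =>
      isLocal_of_rowLocal (Finset.mem_compl.mpr (Finset.mem_filter.mp hi).2) (hq t b u i)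
  have hFp : ∀ t, ∃ hh : MvPolynomial {ij : Fin n × Fin n // ij.1 ∈ S} F,
      Fp t = rename Subtype.val hh := by
    intro t
    refine isLocal_prod _ _ fun b hb => ?_
    have hb' := Finset.mem_filter.mp hb
    have hbNC := Finset.mem_filter.mp hb'.1
    obtain ⟨i₀, hi₀S, hi₀⟩ := hb'.2
    refine isLocal_sum _ _ fun u _ => isLocal_prod _ _ fun i hi => ?_
    have hπ : π t i = b := (Finset.mem_filter.mp hi).2
    have hiS : i ∈ S := by
      by_contra hiS
      exact hbNC.2 ((memCr t b).mpr ⟨⟨i₀, hi₀S, hi₀⟩, ⟨i, hiS, hπ⟩⟩)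
    exact isLocal_of_rowLocal hiS (hq t b u i)
  have hGp : ∀ t, ∃ hh : MvPolynomial {ij : Fin n × Fin n // ij.1 ∈ Sᶜ} F,
      Gp t = rename Subtype.val hh := by
    intro t
    refine isLocal_prod _ _ fun b hb => ?_
    have hb' := Finset.mem_filter.mp hb
    refine isLocal_sum _ _ fun u _ => isLocal_prod _ _ fun i hi => ?_
    have hπ : π t i = b := (Finset.mem_filter.mp hi).2
    have hiS : i ∈ Sᶜ := Finset.mem_compl.mpr fun hiS => hb'.2 ⟨i, hiS, hπ⟩
    exact isLocal_of_rowLocal hiS (hq t b u i)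
  have hfS : ∀ p : Sig, ∃ hh : MvPolynomial {ij : Fin n × Fin n // ij.1 ∈ S} F,
      fS p = rename Subtype.val hh := fun p =>
    isLocal_mul (isLocal_prod _ _ fun b _ => hfq p.1 b (p.2 b)) (hFp p.1)
  have hgS : ∀ p : Sig, ∃ hh : MvPolynomial {ij : Fin n × Fin n // ij.1 ∈ Sᶜ} F,
      gS p = rename Subtype.val hh := fun p =>
    isLocal_mul (isLocal_prod _ _ fun b _ => hgq p.1 b (p.2 b)) (hGp p.1)
  -- the block flattening law
  have hle := RowPartitionRank.choose_le_of_perPoly_eq_sum_mul_blockLocal n (Fintype.card Sig) S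
    (fun k => fS (e.symm k)) (fun k => gS (e.symm k)) (fun k => hfS _) (fun k => hgS _) hper3
  have hcard : Fintype.card Sig = ∑ t, w t ^ (Cr t).card := by
    rw [Fintype.card_sigma]
    refine Finset.sum_congr rfl fun t _ => ?_
    rw [Fintype.card_fun, Fintype.card_coe, Fintype.card_fin]
  rw [hcard] at hle
  exact hle

/-- Corollary: any uniform bound `M` on the cut-crossing sums `Σ_t (w t)^(k_t(S))` over all row sets
`S` satisfies `2^n ≤ (n+1) · M` (sum the law over one `S` of each size). In particular a depth-4
expression of size `2^(o(n))` has, for some cut, a cut-crossing sum `≥ 2^n/(n+1)` — its terms cross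
that cut in many blocks. [cite: NisanWigderson1996, Thm. 3.2 (method)] -/
theorem two_pow_le_succ_mul_sum_pow_crossing (n s : ℕ) (w : Fin s → ℕ)
    (π : Fin s → Fin n → Fin n)
    (q : (t : Fin s) → Fin n → Fin (w t) → Fin n → MvPolynomial (Fin n × Fin n) F)
    (hq : ∀ t b u i, ∃ g : MvPolynomial (Fin n) F, q t b u i = rename (Prod.mk i) g)
    (h : perPoly (Fin n) F = depthFourEval n s w π q)
    (M : ℕ) (hM : ∀ S : Finset (Fin n), ∑ t, w t ^ (crossingBlocks S (π t)).card ≤ M) :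
    2 ^ n ≤ (n + 1) * M := by
  classical
  -- every binomial coefficient is at most `M`, and they sum to `2^n`
  have hk : ∀ k ∈ Finset.range (n + 1), n.choose k ≤ M := by
    intro k hk
    have hkn : k ≤ n := Nat.lt_succ_iff.mp (Finset.mem_range.mp hk)
    -- a `k`-subset of `Fin n`
    obtain ⟨S, -, hS⟩ : ∃ S : Finset (Fin n), S ⊆ univ ∧ S.card = k :=
      Finset.exists_subset_card_eq (by simpa using hkn)
    calc n.choose k = n.choose S.card := by rw [hS]
      _ ≤ ∑ t, w t ^ (crossingBlocks S (π t)).card :=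
          choose_le_sum_pow_crossing n s w π q hq h S
      _ ≤ M := hM S
  calc 2 ^ n = ∑ k ∈ Finset.range (n + 1), n.choose k := (Nat.sum_range_choose n).symm
    _ ≤ ∑ k ∈ Finset.range (n + 1), M := Finset.sum_le_sum hk
    _ = (n + 1) * M := by simp

end

end Summit.ValiantsHypothesis.ValiantsHypothesis.Theorems.CutCrossingLaw
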